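import Literature.NumberTheory.Automorphic.SymplecticKlingenParabolic
import Literature.NumberTheory.Automorphic.SymplecticSiegelParabolic
import Literature.NumberTheory.Automorphic.SymplecticSatakeTransform
import HarnessLib

/-!
# The Klingen descent of the Satake transform of `Sp_{2m+2}` to `Sp_{2m}`: the coefficient of `x^{(k; μ')}` in `𝒮_q(T)` is
# `q^{(m+1)k}` times the coefficient of `x^{μ'}` in the transform of a Hecke operator of `Sp_{2m}`
# (Cartier 1979 §IV, proof of Thm. 4.1 (b); Satake 1963 §7)

Topic `NumberTheory/Automorphic`; namespace `Literature.NumberTheory.Automorphic.SymplecticCartan` (lane `lit-hodgefound`,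
Track 2 foundations; seat `lit-hodgefound-p11`, generation 50, row g50-#4).  DEFINITIONS with bodies (`klingenCoset`,
`consZeroHom`, `klingenFilter`, `klingenVec`, `klingenHeckeOperator`) + theorems; no named fact, no instance, no notation.  The
`Sp_{2n}` analogue of `HyperspecialUnitarySatakeKlingenDescent` (g48-#4), on top of `SymplecticKlingenParabolic` (g50-#3:
the parabolic `P_K`, the Levi projection `P_K → Sp_{2m}`, the lift `L`, the factorisation of the Iwasawa exponents along `P_K`).

## The mathematics

`n = m + 1`, `G = Sp_{2n}(K) ⊇ K₀ = Sp_{2n}(𝒪)`, `G' = Sp_{2m}(K) ⊇ K₀' = Sp_{2m}(𝒪)`, exponents `a : G → ℤⁿ`, `a' : G' → ℤᵐ`.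
Every coset `γ ∈ G/K₀` has a Borel representative `b_γ` (`borelRep`), and `Φ_K(γ) := (b_γ|_{ι×ι}) K₀' ∈ G'/K₀'` is well defined
on `P_K`-representatives and `P_K`-equivariant through the middle block; the exponents factor:
**`a(γ) = (a(γ)₀ ; a'(Φ_K γ))`** (`symplecticIwasawaExp_eq_cons_of_mem_klingen`).  For `T ∈ ℋ_R(G, K₀)` and `k ∈ ℤ` put

  `v_k(T) := Σ_{γ : a(γ)₀ = k} T[K₀](γ) · [Φ_K γ] ∈ R[G'/K₀']`   (`klingenVec`).

(i) `v_k(T)` is `K₀'`-invariant: `k'' ∈ K₀'` lifts to `L(k'') ∈ K₀ ∩ P_K`, which fixes `T[K₀]`, acts on `Φ_K` through `k''`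
and does not change `a(·)₀` (its corner entries are `1`); so `v_k(T) = T'_k[K₀']` for a Hecke operator `T'_k ∈ ℋ_R(G', K₀')`
(`klingenHeckeOperator`).  (ii) For every weight `w : ℤⁿ → R` (multiplicative) and every `μ' ∈ ℤᵐ`:

  `𝒮^G_w(T)_{(k; μ')} = w(k; 0) · ( satakeVec_{G'} (w ∘ (0; ·)) (v_k T) )_{μ'}`

(both sides are `Σ_{γ : a γ = (k; μ')} T[K₀](γ)` times `w(k; μ') = w(k; 0) w(0; μ')`).  (iii) In Cartier's normalisation
`w = q^{⟨ρ_n, ·⟩}`, `ρ_n = (n, n-1, …, 1)`: `w ∘ (0; ·) = q^{⟨ρ_m, ·⟩}` is Cartier's weight of `Sp_{2m}` and `w(k; 0) = q^{n k}`, so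

  **`𝒮^{(n)}_q(T)_{(k; μ')} = q^{n k} · 𝒮^{(m)}_q(T'_k)_{μ'}`** (`coeff_symplecticSatakeTransform_cons`),

which is Cartier's transitivity `S^G = S^M ∘ r^G_M` for the Klingen parabolic (`M = GL_1 × Sp_{2m}`) read coefficientwise.
CONSEQUENCE (the induction step of the Weyl-group invariance, sequel `SymplecticSatakeWeylInvariance`): any symmetry
`μ' ↦ f(μ')` enjoyed by the Satake transforms of ALL of `ℋ_R(Sp_{2m}(K), Sp_{2m}(𝒪))` is enjoyed by those of `Sp_{2m+2}` on the
last `m` coordinates (`coeff_symplecticSatakeTransform_cons_eq_of_forall`).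

## What is formalised

* §1 **`klingenCoset`** `Φ_K`, `klingenCoset_mk`, `klingenCoset_smul`, **`symplecticIwasawaExp_out_succ`**
  (`a(γ)_{i+1} = a'(Φ_K γ)_i`), `symplecticIwasawaExp_out_eq_cons`.
* §2 `klingenCoset_klingenLift_smul` (`Φ_K(L(k'') γ) = k'' Φ_K(γ)`), `apply_inl_zero_klingenLift_mul`,
  **`symplecticIwasawaExp_klingenLift_smul_zero`** (`a(L(k'') γ)₀ = a(γ)₀`).
* §3 `consZeroHom` (`μ' ↦ (0; μ')` as `ℤᵐ →+ ℤⁿ`), `cons_eq_cons_zero_add`, **`klingenFilter`**, **`klingenVec`**, `klingenVec_single`,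
  `ofMulAction_klingenVec`, **`klingenVec_toVector_invariant`**, **`klingenHeckeOperator`** `T'_k`, `toVector_klingenHeckeOperator`.
* §4 **`coeff_satakeVec_cons_eq`** (the identity (ii), every weight, every `R`), `symplecticRhoPairing_cons_zero`,
  `symplecticRhoPairing_cons_zero_right` (`⟨ρ_n, (k; 0)⟩ = n k`), `symplecticSatakeWeight_comp_consZeroHom`,
  **`coeff_symplecticSatakeTransform_cons`** (iii), **`coeff_symplecticSatakeTransform_cons_eq_of_forall`**.

## References
* [CartierCorvallis1979] P. Cartier, *Representations of 𝔭-adic groups: a survey*, PSPM 33.1 (1979), §IV (4.2), Thm. 4.1 and its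
  proof (b).
* [Satake1963] I. Satake, *Theory of spherical functions on reductive algebraic groups over 𝔭-adic fields*, Publ. Math. IHÉS 18
  (1963), §7, §8.3.
* [AndrianovZhuravlev1995] A. N. Andrianov, V. G. Zhuravlev, *Modular Forms and Hecke Operators*, Transl. Math. Monogr. 145
  (1995), Ch. 3 §3.3 (3.44)–(3.49), Thm. 3.30.
* [BruhatTits1972] F. Bruhat, J. Tits, *Groupes réductifs sur un corps local I*, Publ. Math. IHÉS 41 (1972), (4.4.3).
-/

noncomputable section

open scoped Valued WithZero MatrixGroups
open Matrix MonoidAlgebra Representation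

namespace Literature.NumberTheory.Automorphic.SymplecticCartan

open Literature.NumberTheory.Automorphic Literature.NumberTheory.Automorphic.HermitianLattice

variable {K : Type*} [Field K] [Valued K ℤᵐ⁰] {ϖ : K} {m : ℕ}

/-! ## §1 The Klingen coset map `Φ_K : Sp_{2m+2}(K)/Sp_{2m+2}(𝒪) → Sp_{2m}(K)/Sp_{2m}(𝒪)` -/

/-- The Borel representative lies in `P_K`. [cite: AndrianovZhuravlev1995, Ch. 1 §3 Prop. 3.7] -/
theorem borelRep_mem_symplecticKlingenParabolic (hϖ : Valued.v ϖ = WithZero.exp (-1 : ℤ))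
    (γ : symplecticGroup (Fin (m + 1)) K ⧸ symplecticInt (Fin (m + 1)) K) : borelRep hϖ γ ∈ symplecticKlingenParabolic m K :=
  symplecticBorel_le_symplecticKlingenParabolic (borelRep_mem hϖ γ)

/-- **The Klingen coset map** `Φ_K(γ) = (b_γ|_{ι×ι}) Sp_{2m}(𝒪)`. [cite: CartierCorvallis1979, §IV (4.2)] [cite: Satake1963, §7] -/
def klingenCoset (hϖ : Valued.v ϖ = WithZero.exp (-1 : ℤ)) (γ : symplecticGroup (Fin (m + 1)) K ⧸ symplecticInt (Fin (m + 1)) K) :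
    symplecticGroup (Fin m) K ⧸ symplecticInt (Fin m) K :=
  ↑(klingenMidSp m K ⟨borelRep hϖ γ, borelRep_mem_symplecticKlingenParabolic hϖ γ⟩)

/-- Unfolding `Φ_K`. [cite: CartierCorvallis1979, §IV (4.2)] -/
theorem klingenCoset_eq (hϖ : Valued.v ϖ = WithZero.exp (-1 : ℤ)) (γ : symplecticGroup (Fin (m + 1)) K ⧸ symplecticInt (Fin (m + 1)) K) :
    klingenCoset hϖ γ = ↑(klingenMidSp m K ⟨borelRep hϖ γ, borelRep_mem_symplecticKlingenParabolic hϖ γ⟩) := rfl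

/-- **`Φ_K` is well defined on representatives in `P_K`**: `Φ_K(q K₀) = (q|_{ι×ι}) K₀'`. [cite: CartierCorvallis1979, §IV (4.2)] -/
theorem klingenCoset_mk (hϖ : Valued.v ϖ = WithZero.exp (-1 : ℤ)) {q : symplecticGroup (Fin (m + 1)) K}
    (hq : q ∈ symplecticKlingenParabolic m K) :
    klingenCoset hϖ (q : symplecticGroup (Fin (m + 1)) K ⧸ symplecticInt (Fin (m + 1)) K) = ↑(klingenMidSp m K ⟨q, hq⟩) := by
  rw [klingenCoset_eq]
  refine QuotientGroup.eq.2 ?_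
  rw [← map_inv, ← map_mul]
  refine klingenMidSp_mem_symplecticInt ?_
  change (borelRep hϖ _)⁻¹ * q ∈ symplecticInt (Fin (m + 1)) K
  exact QuotientGroup.eq.1 (mk_borelRep hϖ _)

/-- **`Φ_K` is `P_K`-equivariant** through the middle block. [cite: CartierCorvallis1979, §IV (4.2)] -/
theorem klingenCoset_smul (hϖ : Valued.v ϖ = WithZero.exp (-1 : ℤ)) {k : symplecticGroup (Fin (m + 1)) K}
    (hk : k ∈ symplecticKlingenParabolic m K) (γ : symplecticGroup (Fin (m + 1)) K ⧸ symplecticInt (Fin (m + 1)) K) :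
    klingenCoset hϖ (k • γ) = (klingenMidSp m K ⟨k, hk⟩ : symplecticGroup (Fin m) K) • klingenCoset hϖ γ := by
  conv_lhs => rw [← mk_borelRep hϖ γ]
  rw [MulAction.Quotient.smul_coe, smul_eq_mul,
    klingenCoset_mk hϖ ((symplecticKlingenParabolic m K).mul_mem hk (borelRep_mem_symplecticKlingenParabolic hϖ γ)), klingenCoset_eq,
    MulAction.Quotient.smul_coe, smul_eq_mul, ← map_mul]
  rfl

/-- **The exponents factor along `Φ_K`**: `a(γ)_{i+1} = a'(Φ_K γ)_i`. [cite: CartierCorvallis1979, §IV (4.2), proof of Thm. 4.1 (b)]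
[cite: BruhatTits1972, (4.4.3)] -/
theorem symplecticIwasawaExp_out_succ (hϖ : Valued.v ϖ = WithZero.exp (-1 : ℤ))
    (γ : symplecticGroup (Fin (m + 1)) K ⧸ symplecticInt (Fin (m + 1)) K) (i : Fin m) :
    symplecticIwasawaExp hϖ γ.out i.succ = symplecticIwasawaExp hϖ (klingenCoset hϖ γ).out i := by
  rw [symplecticIwasawaExp_out_eq_borelRep, klingenCoset_eq, (isIwasawaExponent_symplectic hϖ).apply_out_coe,
    symplecticIwasawaExp_succ_of_mem_klingen hϖ (borelRep_mem_symplecticKlingenParabolic hϖ γ)]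

/-- `a(γ) = (a(γ)₀ ; a'(Φ_K γ))`. [cite: CartierCorvallis1979, §IV (4.2), proof of Thm. 4.1 (b)] -/
theorem symplecticIwasawaExp_out_eq_cons (hϖ : Valued.v ϖ = WithZero.exp (-1 : ℤ))
    (γ : symplecticGroup (Fin (m + 1)) K ⧸ symplecticInt (Fin (m + 1)) K) :
    symplecticIwasawaExp hϖ γ.out = Fin.cons (symplecticIwasawaExp hϖ γ.out 0) (symplecticIwasawaExp hϖ (klingenCoset hϖ γ).out) := by
  funext i
  refine Fin.cases ?_ (fun j => ?_) i
  · rw [Fin.cons_zero]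
  · rw [Fin.cons_succ, symplecticIwasawaExp_out_succ]

/-! ## §2 The lift `L(k'')` acts on `Φ_K` through `k''` and fixes the first exponent -/

/-- `Φ_K(L(k'') γ) = k'' Φ_K(γ)`. [cite: CartierCorvallis1979, §IV (4.2)] -/
theorem klingenCoset_klingenLift_smul (hϖ : Valued.v ϖ = WithZero.exp (-1 : ℤ)) (k'' : symplecticGroup (Fin m) K)
    (γ : symplecticGroup (Fin (m + 1)) K ⧸ symplecticInt (Fin (m + 1)) K) :
    klingenCoset hϖ (klingenLift m K k'' • γ) = k'' • klingenCoset hϖ γ := by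
  rw [klingenCoset_smul hϖ (klingenLift_mem_symplecticKlingenParabolic k''), klingenMidSp_klingenLift]

omit [Valued K ℤᵐ⁰] in
/-- `(L(k'') g)_{inl 0, inl 0} = g_{inl 0, inl 0}` (the row `inl 0` of `L(k'')` is the unit vector). [cite: AndrianovZhuravlev1995, Ch. 1 §3 Prop. 3.7] -/
theorem apply_inl_zero_klingenLift_mul (k'' : symplecticGroup (Fin m) K) (g : symplecticGroup (Fin (m + 1)) K) :
    ((klingenLift m K k'' * g : symplecticGroup (Fin (m + 1)) K) : Matrix (Fin (m + 1) ⊕ Fin (m + 1)) (Fin (m + 1) ⊕ Fin (m + 1)) K)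
        (Sum.inl 0) (Sum.inl 0) =
      (g : Matrix (Fin (m + 1) ⊕ Fin (m + 1)) (Fin (m + 1) ⊕ Fin (m + 1)) K) (Sum.inl 0) (Sum.inl 0) := by
  rw [Submonoid.coe_mul, Matrix.mul_apply, sum_eq_add_add_sum_klingenIndex, coe_klingenLift, klingenLiftMatrix_inl_zero_inr_zero,
    zero_mul, zero_add, klingenLiftMatrix_inl_zero_inl_zero, one_mul, Finset.sum_eq_zero fun u _ => ?_, add_zero]
  rw [klingenLiftMatrix_inl_zero_klingenIndex, zero_mul]

/-- **The lift does not change the first exponent**: `a(L(k'') γ)₀ = a(γ)₀`. [cite: CartierCorvallis1979, §IV (4.2), proof of Thm. 4.1 (b)] -/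
theorem symplecticIwasawaExp_klingenLift_smul_zero (hϖ : Valued.v ϖ = WithZero.exp (-1 : ℤ)) (k'' : symplecticGroup (Fin m) K)
    (γ : symplecticGroup (Fin (m + 1)) K ⧸ symplecticInt (Fin (m + 1)) K) :
    symplecticIwasawaExp hϖ (klingenLift m K k'' • γ).out 0 = symplecticIwasawaExp hϖ γ.out 0 := by
  have hL := klingenLift_mem_symplecticKlingenParabolic (K := K) k''
  have hb := borelRep_mem_symplecticKlingenParabolic hϖ γ
  have h1 : symplecticIwasawaExp hϖ (klingenLift m K k'' • γ).out = symplecticIwasawaExp hϖ (klingenLift m K k'' * borelRep hϖ γ) := by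
    refine (isIwasawaExponent_symplectic hϖ).eq_of_coe_eq ?_
    rw [QuotientGroup.out_eq', ← mk_borelRep hϖ γ, MulAction.Quotient.smul_coe, smul_eq_mul, mk_borelRep]
  have e1 := v_apply_inl_zero_of_mem_klingen hϖ ((symplecticKlingenParabolic m K).mul_mem hL hb)
  have e2 := v_apply_inl_zero_of_mem_klingen hϖ hb
  rw [apply_inl_zero_klingenLift_mul, e2] at e1
  have := WithZero.exp_injective e1
  rw [h1, symplecticIwasawaExp_out_eq_borelRep hϖ γ]
  omega

/-! ## §3 The vectors `v_k(T) ∈ R[Sp_{2m}(K)/Sp_{2m}(𝒪)]` and the Hecke operators `T'_k` -/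

section Vectors

variable {R : Type*} [CommRing R]

/-- `μ' ↦ (0; μ')` as an additive homomorphism `ℤᵐ →+ ℤ^{m+1}`. [folklore] -/
def consZeroHom (m : ℕ) : (Fin m → ℤ) →+ (Fin (m + 1) → ℤ) where
  toFun μ' := Fin.cons 0 μ'
  map_zero' := by
    funext i
    refine Fin.cases ?_ (fun j => ?_) i
    · rw [Fin.cons_zero, Pi.zero_apply]
    · rw [Fin.cons_succ, Pi.zero_apply, Pi.zero_apply]
  map_add' μ' ν' := by
    funext i
    refine Fin.cases ?_ (fun j => ?_) i
    · rw [Pi.add_apply, Fin.cons_zero, Fin.cons_zero, Fin.cons_zero, add_zero]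
    · rw [Pi.add_apply, Fin.cons_succ, Fin.cons_succ, Fin.cons_succ, Pi.add_apply]

/-- `consZeroHom μ' = (0; μ')` (the cocharacters of the `Sp_{2m}`-factor of the Klingen Levi). [cite: Satake1963, §7] -/
@[simp] theorem consZeroHom_apply (μ' : Fin m → ℤ) : consZeroHom m μ' = Fin.cons 0 μ' := rfl

/-- `(k; μ') = (k; 0) + (0; μ')` (cocharacters of `GL_1 × Sp_{2m}`). [cite: Satake1963, §7] -/
theorem cons_eq_cons_zero_add (k : ℤ) (μ' : Fin m → ℤ) :
    (Fin.cons k μ' : Fin (m + 1) → ℤ) = Fin.cons k (0 : Fin m → ℤ) + Fin.cons 0 μ' := by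
  funext i
  refine Fin.cases ?_ (fun j => ?_) i
  · rw [Pi.add_apply, Fin.cons_zero, Fin.cons_zero, Fin.cons_zero, add_zero]
  · rw [Pi.add_apply, Fin.cons_succ, Fin.cons_succ, Fin.cons_succ, Pi.zero_apply, zero_add]

/-- **The restriction of a vector to the cosets with first exponent `k`** (`x ↦ Σ_{a(γ)₀ = k} x_γ [γ]`), `R`-linear.
[cite: CartierCorvallis1979, §IV (4.2)] -/
def klingenFilter (hϖ : Valued.v ϖ = WithZero.exp (-1 : ℤ)) (k : ℤ) :
    MonoidAlgebra R (symplecticGroup (Fin (m + 1)) K ⧸ symplecticInt (Fin (m + 1)) K) →ₗ[R]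
      MonoidAlgebra R (symplecticGroup (Fin (m + 1)) K ⧸ symplecticInt (Fin (m + 1)) K) where
  toFun x := MonoidAlgebra.ofCoeff (x.coeff.filter fun γ => symplecticIwasawaExp hϖ γ.out 0 = k)
  map_add' x y := by rw [MonoidAlgebra.coeff_add, Finsupp.filter_add, MonoidAlgebra.ofCoeff_add]
  map_smul' c x := by rw [MonoidAlgebra.coeff_smul, Finsupp.filter_smul, MonoidAlgebra.ofCoeff_smul, RingHom.id_apply]

/-- `klingenFilter` on a basis vector. [cite: CartierCorvallis1979, §IV (4.2)] -/
theorem klingenFilter_single (hϖ : Valued.v ϖ = WithZero.exp (-1 : ℤ)) (k : ℤ)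
    (γ : symplecticGroup (Fin (m + 1)) K ⧸ symplecticInt (Fin (m + 1)) K) (r : R) :
    klingenFilter (R := R) hϖ k (single γ r) = if symplecticIwasawaExp hϖ γ.out 0 = k then single γ r else 0 := by
  change MonoidAlgebra.ofCoeff ((single γ r).coeff.filter fun γ => symplecticIwasawaExp hϖ γ.out 0 = k) = _
  rw [MonoidAlgebra.coeff_single]
  split_ifs with h
  · rw [Finsupp.filter_single_of_pos
      (fun γ' : symplecticGroup (Fin (m + 1)) K ⧸ symplecticInt (Fin (m + 1)) K => symplecticIwasawaExp hϖ γ'.out 0 = k) h,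
      MonoidAlgebra.ofCoeff_single]
  · rw [Finsupp.filter_single_of_neg
      (fun γ' : symplecticGroup (Fin (m + 1)) K ⧸ symplecticInt (Fin (m + 1)) K => symplecticIwasawaExp hϖ γ'.out 0 = k) h,
      MonoidAlgebra.ofCoeff_zero]

/-- **The Klingen push-forward `v_k : R[G/K₀] → R[G'/K₀']`**, `x ↦ Σ_{a(γ)₀ = k} x_γ [Φ_K γ]`. [cite: CartierCorvallis1979, §IV (4.2)]
[cite: Satake1963, §7] -/
def klingenVec (hϖ : Valued.v ϖ = WithZero.exp (-1 : ℤ)) (k : ℤ) :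
    MonoidAlgebra R (symplecticGroup (Fin (m + 1)) K ⧸ symplecticInt (Fin (m + 1)) K) →ₗ[R]
      MonoidAlgebra R (symplecticGroup (Fin m) K ⧸ symplecticInt (Fin m) K) :=
  MonoidAlgebra.mapDomainLinearMap R R (klingenCoset hϖ) ∘ₗ klingenFilter hϖ k

/-- `v_k` on a basis vector: `[γ] ↦ [Φ_K γ]` if `a(γ)₀ = k`, else `0`. [cite: CartierCorvallis1979, §IV (4.2)] -/
theorem klingenVec_single (hϖ : Valued.v ϖ = WithZero.exp (-1 : ℤ)) (k : ℤ)
    (γ : symplecticGroup (Fin (m + 1)) K ⧸ symplecticInt (Fin (m + 1)) K) (r : R) :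
    klingenVec (R := R) hϖ k (single γ r) = if symplecticIwasawaExp hϖ γ.out 0 = k then single (klingenCoset hϖ γ) r else 0 := by
  rw [klingenVec, LinearMap.comp_apply, klingenFilter_single]
  split_ifs
  · rw [MonoidAlgebra.mapDomainLinearMap_single]
  · rw [map_zero]

/-- **`v_k` intertwines `L(k'')` with `k''`**: `k'' · v_k(x) = v_k(L(k'') · x)`. [cite: CartierCorvallis1979, §IV (4.2)] -/
theorem ofMulAction_klingenVec (hϖ : Valued.v ϖ = WithZero.exp (-1 : ℤ)) (k : ℤ) (k'' : symplecticGroup (Fin m) K)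
    (x : MonoidAlgebra R (symplecticGroup (Fin (m + 1)) K ⧸ symplecticInt (Fin (m + 1)) K)) :
    ofMulAction R (symplecticGroup (Fin m) K) (symplecticGroup (Fin m) K ⧸ symplecticInt (Fin m) K) k'' (klingenVec hϖ k x) =
      klingenVec hϖ k (ofMulAction R (symplecticGroup (Fin (m + 1)) K)
        (symplecticGroup (Fin (m + 1)) K ⧸ symplecticInt (Fin (m + 1)) K) (klingenLift m K k'') x) := by
  induction x using MonoidAlgebra.induction_linear with
  | zero => simp only [map_zero]
  | add x y hx hy => rw [map_add, map_add, map_add, map_add, hx, hy]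
  | single γ r =>
    rw [klingenVec_single, ofMulAction_single, klingenVec_single, symplecticIwasawaExp_klingenLift_smul_zero,
      klingenCoset_klingenLift_smul]
    split_ifs
    · rw [ofMulAction_single]
    · rw [map_zero]

/-- **`v_k(T[K₀])` is `Sp_{2m}(𝒪)`-invariant.** [cite: CartierCorvallis1979, §IV (4.2)] [cite: BruhatTits1972, (4.4.3)] -/
theorem klingenVec_toVector_invariant (hϖ : Valued.v ϖ = WithZero.exp (-1 : ℤ)) (k : ℤ)
    (T : heckeAlgebra R (symplecticGroup (Fin (m + 1)) K) (symplecticInt (Fin (m + 1)) K)) (k'' : symplecticGroup (Fin m) K)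
    (hk'' : k'' ∈ symplecticInt (Fin m) K) :
    ofMulAction R (symplecticGroup (Fin m) K) (symplecticGroup (Fin m) K ⧸ symplecticInt (Fin m) K) k''
        (klingenVec hϖ k (heckeAlgebra.toVector (symplecticInt (Fin (m + 1)) K) T)) =
      klingenVec hϖ k (heckeAlgebra.toVector (symplecticInt (Fin (m + 1)) K) T) := by
  rw [ofMulAction_klingenVec, heckeAlgebra.ofMulAction_toVector _ T (klingenLift_mem_symplecticInt hk'')]

/-- **The Hecke operator `T'_k ∈ ℋ_R(Sp_{2m}(K), Sp_{2m}(𝒪))` with `T'_k[K₀'] = v_k(T[K₀])`.** [cite: CartierCorvallis1979, §IV (4.2),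
proof of Thm. 4.1 (b)] [cite: Satake1963, §7] -/
def klingenHeckeOperator (hϖ : Valued.v ϖ = WithZero.exp (-1 : ℤ)) (k : ℤ)
    (T : heckeAlgebra R (symplecticGroup (Fin (m + 1)) K) (symplecticInt (Fin (m + 1)) K)) :
    heckeAlgebra R (symplecticGroup (Fin m) K) (symplecticInt (Fin m) K) :=
  heckeAlgebra.ofVector (symplecticInt (Fin m) K) (klingenVec hϖ k (heckeAlgebra.toVector (symplecticInt (Fin (m + 1)) K) T))
    fun k'' hk'' => klingenVec_toVector_invariant hϖ k T k'' hk''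

/-- `T'_k[K₀'] = v_k(T[K₀])`. [cite: CartierCorvallis1979, §IV (4.2)] -/
theorem toVector_klingenHeckeOperator (hϖ : Valued.v ϖ = WithZero.exp (-1 : ℤ)) (k : ℤ)
    (T : heckeAlgebra R (symplecticGroup (Fin (m + 1)) K) (symplecticInt (Fin (m + 1)) K)) :
    heckeAlgebra.toVector (symplecticInt (Fin m) K) (klingenHeckeOperator hϖ k T) =
      klingenVec hϖ k (heckeAlgebra.toVector (symplecticInt (Fin (m + 1)) K) T) :=
  heckeAlgebra.toVector_ofVector _ _ _

/-- `T ↦ T'_k` is additive. [cite: CartierCorvallis1979, §IV (4.2)] -/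
theorem klingenHeckeOperator_add (hϖ : Valued.v ϖ = WithZero.exp (-1 : ℤ)) (k : ℤ)
    (S T : heckeAlgebra R (symplecticGroup (Fin (m + 1)) K) (symplecticInt (Fin (m + 1)) K)) :
    klingenHeckeOperator hϖ k (S + T) = klingenHeckeOperator hϖ k S + klingenHeckeOperator hϖ k T := by
  apply heckeAlgebra.toVector_injective (symplecticInt (Fin m) K)
  rw [map_add, toVector_klingenHeckeOperator, toVector_klingenHeckeOperator, toVector_klingenHeckeOperator, map_add, map_add]

end Vectors

/-! ## §4 The descent identity on coefficients -/

section Descent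

variable {R : Type*} [CommRing R]

/-- Coefficient of a monomial. [folklore] -/
private theorem coeff_single_apply' {Λ : Type*} (l μ : Λ) (c : R) [Decidable (l = μ)] :
    (AddMonoidAlgebra.single l c).coeff μ = if l = μ then c else 0 := by
  rw [AddMonoidAlgebra.coeff_single, Finsupp.single_apply]

/-- **THE KLINGEN DESCENT IDENTITY ON COEFFICIENTS** (every weight, every `R`): for `T[K₀] = x ∈ R[G/K₀]`,
`(satakeVec_G w x)_{(k; μ')} = w(k; 0) · (satakeVec_{G'} (w ∘ (0;·)) (v_k x))_{μ'}`. [cite: CartierCorvallis1979, §IV (4.2), Thm. 4.1]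
[cite: Satake1963, §7] -/
theorem coeff_satakeVec_cons_eq (hϖ : Valued.v ϖ = WithZero.exp (-1 : ℤ)) (w : Multiplicative (Fin (m + 1) → ℤ) →* R)
    (x : MonoidAlgebra R (symplecticGroup (Fin (m + 1)) K ⧸ symplecticInt (Fin (m + 1)) K)) (k : ℤ) (μ' : Fin m → ℤ) :
    (IsIwasawaExponent.satakeVec (symplecticInt (Fin (m + 1)) K) (symplecticIwasawaExp hϖ) w x).coeff (Fin.cons k μ') =
      w (Multiplicative.ofAdd (Fin.cons k (0 : Fin m → ℤ))) *
        (IsIwasawaExponent.satakeVec (symplecticInt (Fin m) K) (symplecticIwasawaExp hϖ)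
          (w.comp (AddMonoidHom.toMultiplicative (consZeroHom m))) (klingenVec hϖ k x)).coeff μ' := by
  classical
  induction x using MonoidAlgebra.induction_linear with
  | zero => simp only [map_zero, AddMonoidAlgebra.coeff_zero, Finsupp.zero_apply, mul_zero]
  | add x y hx hy =>
    rw [map_add, map_add, map_add, AddMonoidAlgebra.coeff_add, AddMonoidAlgebra.coeff_add, Finsupp.add_apply, Finsupp.add_apply,
      hx, hy, mul_add]
  | single γ r =>
    rw [IsIwasawaExponent.satakeVec_single, coeff_single_apply', klingenVec_single]
    have hcons := symplecticIwasawaExp_out_eq_cons hϖ γ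
    by_cases hk : symplecticIwasawaExp hϖ γ.out 0 = k
    · rw [if_pos hk, IsIwasawaExponent.satakeVec_single, coeff_single_apply']
      by_cases hμ : symplecticIwasawaExp hϖ (klingenCoset hϖ γ).out = μ'
      · have heq : symplecticIwasawaExp hϖ γ.out = Fin.cons k μ' := by rw [hcons, hk, hμ]
        rw [if_pos heq, if_pos hμ, heq, hμ, cons_eq_cons_zero_add k μ', ofAdd_add, map_mul, MonoidHom.comp_apply,
          AddMonoidHom.toMultiplicative_apply_apply, toAdd_ofAdd, consZeroHom_apply]
        ring
      · have hne : symplecticIwasawaExp hϖ γ.out ≠ Fin.cons k μ' := fun h => hμ (by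
          have h' := h; rw [hcons] at h'; exact Fin.cons_injective2.eq_iff.1 h' |>.2)
        rw [if_neg hne, if_neg hμ, mul_zero]
    · have hne : symplecticIwasawaExp hϖ γ.out ≠ Fin.cons k μ' := fun h => hk (by rw [h, Fin.cons_zero])
      rw [if_neg hne, if_neg hk, map_zero, AddMonoidAlgebra.coeff_zero, Finsupp.zero_apply, mul_zero]

/-- `⟨ρ_{m+1}, (0; μ')⟩ = ⟨ρ_m, μ'⟩`: dropping the first coordinate of `ρ_{m+1} = (m+1, m, …, 1)` gives `ρ_m`.
[cite: CartierCorvallis1979, §IV (4.2)] -/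
theorem symplecticRhoPairing_cons_zero (μ' : Fin m → ℤ) :
    symplecticRhoPairing (Fin.cons 0 μ' : Fin (m + 1) → ℤ) = symplecticRhoPairing μ' := by
  rw [symplecticRhoPairing, symplecticRhoPairing, Fin.sum_univ_succ, Fin.cons_zero, mul_zero, zero_add]
  refine Finset.sum_congr rfl fun j _ => ?_
  rw [Fin.cons_succ, Fin.val_succ]
  push_cast
  ring

/-- `⟨ρ_{m+1}, (k; 0)⟩ = (m+1) k`. [cite: CartierCorvallis1979, §IV (4.2)] -/
theorem symplecticRhoPairing_cons_zero_right (k : ℤ) :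
    symplecticRhoPairing (Fin.cons k (0 : Fin m → ℤ) : Fin (m + 1) → ℤ) = ((m + 1 : ℕ) : ℤ) * k := by
  rw [symplecticRhoPairing, Fin.sum_univ_succ, Fin.cons_zero, Finset.sum_eq_zero fun j _ => ?_, add_zero]
  · simp
  · rw [Fin.cons_succ, Pi.zero_apply, mul_zero]

/-- **Cartier's weight restricts to Cartier's weight**: `q^{⟨ρ_{m+1}, (0;·)⟩} = q^{⟨ρ_m, ·⟩}`. [cite: CartierCorvallis1979, §IV (4.2)] -/
theorem symplecticSatakeWeight_comp_consZeroHom (q : Rˣ) :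
    (symplecticSatakeWeight (n := m + 1) q).comp (AddMonoidHom.toMultiplicative (consZeroHom m)) = symplecticSatakeWeight (n := m) q := by
  refine MonoidHom.ext fun l => ?_
  have hl : l = Multiplicative.ofAdd (Multiplicative.toAdd l) := rfl
  rw [hl, MonoidHom.comp_apply, AddMonoidHom.toMultiplicative_apply_apply, toAdd_ofAdd, consZeroHom_apply, symplecticSatakeWeight_ofAdd,
    symplecticSatakeWeight_ofAdd, symplecticRhoPairing_cons_zero]

/-- **THE KLINGEN DESCENT IN CARTIER'S NORMALISATION**: `𝒮^{(m+1)}_q(T)_{(k; μ')} = q^{(m+1) k} · 𝒮^{(m)}_q(T'_k)_{μ'}`.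
[cite: CartierCorvallis1979, §IV (4.2), Thm. 4.1 and its proof (b)] [cite: Satake1963, §7] [cite: AndrianovZhuravlev1995, Ch. 3 §3.3 Thm. 3.30] -/
theorem coeff_symplecticSatakeTransform_cons (hϖ : Valued.v ϖ = WithZero.exp (-1 : ℤ)) (q : Rˣ)
    (T : heckeAlgebra R (symplecticGroup (Fin (m + 1)) K) (symplecticInt (Fin (m + 1)) K)) (k : ℤ) (μ' : Fin m → ℤ) :
    (symplecticSatakeTransform hϖ q T).coeff (Fin.cons k μ') =
      ((q ^ (((m + 1 : ℕ) : ℤ) * k) : Rˣ) : R) * (symplecticSatakeTransform hϖ q (klingenHeckeOperator hϖ k T)).coeff μ' := by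
  rw [symplecticSatakeTransform_apply, symplecticSatakeTransform_apply, toVector_klingenHeckeOperator, coeff_satakeVec_cons_eq,
    symplecticSatakeWeight_comp_consZeroHom, symplecticSatakeWeight_ofAdd, symplecticRhoPairing_cons_zero_right]

/-- **INDUCTION STEP OF THE WEYL-GROUP INVARIANCE**: a symmetry `μ' ↦ f μ'` of the Satake transforms of all of
`ℋ_R(Sp_{2m}(K), Sp_{2m}(𝒪))` is a symmetry of the Satake transforms of `ℋ_R(Sp_{2m+2}(K), Sp_{2m+2}(𝒪))` in the last `m`
coordinates. [cite: CartierCorvallis1979, §IV Thm. 4.1, proof (b)] [cite: Satake1963, §7] -/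
theorem coeff_symplecticSatakeTransform_cons_eq_of_forall (hϖ : Valued.v ϖ = WithZero.exp (-1 : ℤ)) (q : Rˣ)
    {f : (Fin m → ℤ) → (Fin m → ℤ)}
    (hf : ∀ (T' : heckeAlgebra R (symplecticGroup (Fin m) K) (symplecticInt (Fin m) K)) (μ' : Fin m → ℤ),
      (symplecticSatakeTransform hϖ q T').coeff (f μ') = (symplecticSatakeTransform hϖ q T').coeff μ')
    (T : heckeAlgebra R (symplecticGroup (Fin (m + 1)) K) (symplecticInt (Fin (m + 1)) K)) (k : ℤ) (μ' : Fin m → ℤ) :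
    (symplecticSatakeTransform hϖ q T).coeff (Fin.cons k (f μ')) = (symplecticSatakeTransform hϖ q T).coeff (Fin.cons k μ') := by
  rw [coeff_symplecticSatakeTransform_cons, coeff_symplecticSatakeTransform_cons, hf]

end Descent

end Literature.NumberTheory.Automorphic.SymplecticCartan

end
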